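import Summits.CriticalPhenomena.PercolationContinuityZ3.Theorems.PercNearOneGluingNoHeavyLowerTailHybridRowsLeFive
import Summits.CriticalPhenomena.PercolationContinuityZ3.Theorems.PercNearOneGluingNoHeavyLowerTailE3GroupSepLeFive

/-!
# `NoHeavyLowerTail` (crux stmt-CriticalPhenomena-4575), master family: ALL 54 ESSENTIAL increasing cubic (`E₃`) rows on FOUR marked points hold on
# every weighted graph with at most five vertices, for ALL edge weights — kernel-checked three-copy comb certificates (companion of `…FrontierDecRowsLeFive`)

Support file (prover seat `prim-bnk-1`, bounded-n kernel theorems; `--supports stmt-CriticalPhenomena-4575`; COMPUTATIONAL: 108 `checkC` evaluations use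
`native_decide`).

Context.  The increasing side of prim-masterthm-p1's 4-point cubic frontier (run/shared/lean/prim/prim-masterthm/prim-masterthm-p1/FRONTIER-4PT.md, INC table,
census complete 2026-08-20T05:52Z, jobs j083551/j086570/j084118): of the `2300` unordered triples of the 25 group-CONNECTION events `U[X|Y] = {some terminal of X is
joined to some terminal of Y}` (increasing; complements of the separations `D[X|Y]`), `814` triples in `54` orbits of `S₄` are ESSENTIAL (not Harris-generated); only 4
orbits are consequences of the proved increasing cubics `T_inc, α, β` + Harris (closure v1), **50 orbits (768 rows) are not** — among them `γ = (U[ab|cy], U[ac|by], U[ay|bc])`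
(`GammaRow`, the open generator of the increasing E3GRP sunflower class) and the increasing star `(U[a|b], U[a|c], U[a|y])`.  (Several of the 50 have meanwhile been proved for
all `n` by switching certificates — prim-masterthm-p1's `Finc` rows, prim-e3grp — that status is NOT tracked in the table below.)  All are census-clean, and all `314 626`
canonical monotone 4-terminal pattern triples are three-copy comb positive on `K₄`, `K₅` (prim-bnk-1 kit atlas j077089, INC fail = 0).

**Theorems.**  For each essential increasing orbit `i : Fin 54` (representative `row i`, table below, same order as the INC table of FRONTIER-4PT.md):
* `frontier_le_five i : ∀ n ≤ 5, ∀ w, ∀ a b c y` pairwise distinct, `0 ≤ cval w (e3Terms U₁ U₂ U₃)`;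
* `frontier_sahiE3_le_five i`: `0 ≤ sahiE3 (prodBernoulli w) (connEvent U₁) (connEvent U₂) (connEvent U₃)` (`E3GroupSepCert.connEvent_lnk` unfolds `connEvent (lnk X Y)`
  to `{ω | ∃ x ∈ X, ∃ y ∈ Y, ω ∈ openConn x y}`);
* spelled out: `gamma_le_five` (`i = 53`) and `incStar_le_five` (`i = 51`: `0 ≤ E₃({a↔b}, {a↔c}, {a↔y})`).
PROOF = `CombRows.quad_cval_le_five` (equivariance by `rfl`; `checkC` at the standard quadruple of `K₄`, base `2^23`, and `K₅`, base `2^35`: all `4^6` resp. `4^10`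
tensor-Bernstein fibre sums nonnegative).  Each theorem covers the whole `S₄`-orbit of its representative.  NOTHING is claimed beyond five vertices.

| `i` | representative `(U₁, U₂, U₃)` | orbit size | implied by {T_inc, α, β} + Harris (FRONTIER-4PT INC, closure v1)? |
|---|---|---|---|
| 0 | `U[abc|y], U[aby|c], U[ac|b]` | 24 | NO (24/24) |
| 1 | `U[abc|y], U[ab|c], U[ac|by]` | 24 | NO (24/24) |
| 2 | `U[abc|y], U[ab|c], U[ay|b]` | 24 | NO (24/24) |
| 3 | `U[abc|y], U[ab|c], U[ay|c]` | 24 | NO (24/24) |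
| 4 | `U[abc|y], U[ab|c], U[a|cy]` | 24 | NO (24/24) |
| 5 | `U[abc|y], U[ab|cy], U[ay|b]` | 24 | NO (24/24) |
| 6 | `U[abc|y], U[ab|cy], U[ay|c]` | 24 | NO (24/24) |
| 7 | `U[abc|y], U[ay|b], U[a|c]` | 24 | NO (24/24) |
| 8 | `U[abc|y], U[ay|b], U[a|cy]` | 24 | NO (24/24) |
| 9 | `U[abc|y], U[ay|b], U[b|c]` | 24 | NO (24/24) |
| 10 | `U[ab|c], U[ab|y], U[ac|b]` | 24 | NO (24/24) |
| 11 | `U[ab|c], U[ac|b], U[ay|b]` | 24 | NO (24/24) |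
| 12 | `U[ab|c], U[ac|b], U[a|by]` | 24 | yes |
| 13 | `U[ab|c], U[ac|b], U[b|y]` | 24 | NO (24/24) |
| 14 | `U[ab|c], U[ac|by], U[ay|b]` | 24 | NO (24/24) |
| 15 | `U[ab|c], U[ac|by], U[b|y]` | 24 | NO (24/24) |
| 16 | `U[ab|c], U[ac|y], U[a|b]` | 24 | NO (24/24) |
| 17 | `U[ab|c], U[ac|y], U[a|by]` | 24 | NO (24/24) |
| 18 | `U[ab|c], U[ac|y], U[b|y]` | 24 | NO (24/24) |
| 19 | `U[ab|c], U[a|b], U[a|y]` | 24 | NO (24/24) |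
| 20 | `U[abc|y], U[aby|c], U[ac|by]` | 12 | NO (12/12) |
| 21 | `U[abc|y], U[aby|c], U[a|cy]` | 12 | NO (12/12) |
| 22 | `U[abc|y], U[ab|c], U[ac|b]` | 12 | NO (12/12) |
| 23 | `U[abc|y], U[ab|c], U[a|b]` | 12 | NO (12/12) |
| 24 | `U[abc|y], U[ab|cy], U[ac|by]` | 12 | NO (12/12) |
| 25 | `U[abc|y], U[ab|cy], U[a|b]` | 12 | NO (12/12) |
| 26 | `U[abc|y], U[ay|b], U[ay|c]` | 12 | NO (12/12) |
| 27 | `U[abc|y], U[ay|b], U[a|by]` | 12 | yes |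
| 28 | `U[abc|y], U[ay|b], U[b|cy]` | 12 | NO (12/12) |
| 29 | `U[abc|y], U[a|b], U[a|c]` | 12 | NO (12/12) |
| 30 | `U[ab|c], U[ab|y], U[ac|by]` | 12 | NO (12/12) |
| 31 | `U[ab|c], U[ab|y], U[a|cy]` | 12 | NO (12/12) |
| 32 | `U[ab|c], U[ac|b], U[ay|bc]` | 12 | NO (12/12) |
| 33 | `U[ab|c], U[ac|b], U[a|y]` | 12 | NO (12/12) |
| 34 | `U[ab|c], U[ac|b], U[bc|y]` | 12 | NO (12/12) |
| 35 | `U[ab|c], U[ac|by], U[ay|bc]` | 12 | NO (12/12) |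
| 36 | `U[ab|c], U[ac|by], U[ay|c]` | 12 | NO (12/12) |
| 37 | `U[ab|c], U[ac|by], U[a|cy]` | 12 | NO (12/12) |
| 38 | `U[ab|c], U[ac|by], U[b|cy]` | 12 | NO (12/12) |
| 39 | `U[ab|c], U[ac|y], U[bc|y]` | 12 | NO (12/12) |
| 40 | `U[ab|c], U[a|b], U[c|y]` | 12 | NO (12/12) |
| 41 | `U[ab|c], U[a|cy], U[b|y]` | 12 | NO (12/12) |
| 42 | `U[ab|c], U[a|y], U[b|y]` | 12 | NO (12/12) |
| 43 | `U[a|b], U[a|c], U[b|y]` | 12 | NO (12/12) |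
| 44 | `U[ab|c], U[ac|y], U[ay|b]` | 8 | NO (8/8) |
| 45 | `U[abc|y], U[aby|c], U[ab|cy]` | 6 | yes |
| 46 | `U[abc|y], U[aby|c], U[a|b]` | 6 | NO (6/6) |
| 47 | `U[ab|c], U[ab|y], U[a|b]` | 6 | NO (6/6) |
| 48 | `U[abc|y], U[aby|c], U[acy|b]` | 4 | NO (4/4) |
| 49 | `U[ab|c], U[ac|b], U[a|bc]` (= T_inc) | 4 | yes |
| 50 | `U[ab|c], U[ay|c], U[by|c]` | 4 | NO (4/4) |
| 51 | `U[a|b], U[a|c], U[a|y]` **(increasing star)** | 4 | NO (4/4) |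
| 52 | `U[ab|cy], U[a|b], U[c|y]` | 3 | NO (3/3) |
| 53 | `U[ab|cy], U[ac|by], U[ay|bc]` **(γ = GammaRow)** | 1 | NO (1/1) |
-/

namespace Summit.CriticalPhenomena.PercolationContinuityZ3.Theorems.FrontierIncRows

open Finset MeasureTheory OneCutCert CovTransferCert E3GroupSepCert CombRows HybridRows
open scoped BigOperators
open Literature.Probability.Percolation Literature.Probability.LatticeModels

variable {n : ℕ}

/-- The 54 representative triples (order of the INC table of FRONTIER-4PT.md), as `lnk` predicates at the quadruple `(a,b,c,y)`. [this work] -/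
def row (i : Fin 54) (n : ℕ) (x : Quad n) : (CRel n → Bool) × (CRel n → Bool) × (CRel n → Bool) :=
  let a := x.1
  let b := x.2.1
  let c := x.2.2.1
  let y := x.2.2.2
  match i with
  | 0 => (lnk [a, b, c] [y], lnk [a, b, y] [c], lnk [a, c] [b])
  | 1 => (lnk [a, b, c] [y], lnk [a, b] [c], lnk [a, c] [b, y])
  | 2 => (lnk [a, b, c] [y], lnk [a, b] [c], lnk [a, y] [b])
  | 3 => (lnk [a, b, c] [y], lnk [a, b] [c], lnk [a, y] [c])
  | 4 => (lnk [a, b, c] [y], lnk [a, b] [c], lnk [a] [c, y])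
  | 5 => (lnk [a, b, c] [y], lnk [a, b] [c, y], lnk [a, y] [b])
  | 6 => (lnk [a, b, c] [y], lnk [a, b] [c, y], lnk [a, y] [c])
  | 7 => (lnk [a, b, c] [y], lnk [a, y] [b], lnk [a] [c])
  | 8 => (lnk [a, b, c] [y], lnk [a, y] [b], lnk [a] [c, y])
  | 9 => (lnk [a, b, c] [y], lnk [a, y] [b], lnk [b] [c])
  | 10 => (lnk [a, b] [c], lnk [a, b] [y], lnk [a, c] [b])
  | 11 => (lnk [a, b] [c], lnk [a, c] [b], lnk [a, y] [b])
  | 12 => (lnk [a, b] [c], lnk [a, c] [b], lnk [a] [b, y])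
  | 13 => (lnk [a, b] [c], lnk [a, c] [b], lnk [b] [y])
  | 14 => (lnk [a, b] [c], lnk [a, c] [b, y], lnk [a, y] [b])
  | 15 => (lnk [a, b] [c], lnk [a, c] [b, y], lnk [b] [y])
  | 16 => (lnk [a, b] [c], lnk [a, c] [y], lnk [a] [b])
  | 17 => (lnk [a, b] [c], lnk [a, c] [y], lnk [a] [b, y])
  | 18 => (lnk [a, b] [c], lnk [a, c] [y], lnk [b] [y])
  | 19 => (lnk [a, b] [c], lnk [a] [b], lnk [a] [y])
  | 20 => (lnk [a, b, c] [y], lnk [a, b, y] [c], lnk [a, c] [b, y])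
  | 21 => (lnk [a, b, c] [y], lnk [a, b, y] [c], lnk [a] [c, y])
  | 22 => (lnk [a, b, c] [y], lnk [a, b] [c], lnk [a, c] [b])
  | 23 => (lnk [a, b, c] [y], lnk [a, b] [c], lnk [a] [b])
  | 24 => (lnk [a, b, c] [y], lnk [a, b] [c, y], lnk [a, c] [b, y])
  | 25 => (lnk [a, b, c] [y], lnk [a, b] [c, y], lnk [a] [b])
  | 26 => (lnk [a, b, c] [y], lnk [a, y] [b], lnk [a, y] [c])
  | 27 => (lnk [a, b, c] [y], lnk [a, y] [b], lnk [a] [b, y])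
  | 28 => (lnk [a, b, c] [y], lnk [a, y] [b], lnk [b] [c, y])
  | 29 => (lnk [a, b, c] [y], lnk [a] [b], lnk [a] [c])
  | 30 => (lnk [a, b] [c], lnk [a, b] [y], lnk [a, c] [b, y])
  | 31 => (lnk [a, b] [c], lnk [a, b] [y], lnk [a] [c, y])
  | 32 => (lnk [a, b] [c], lnk [a, c] [b], lnk [a, y] [b, c])
  | 33 => (lnk [a, b] [c], lnk [a, c] [b], lnk [a] [y])
  | 34 => (lnk [a, b] [c], lnk [a, c] [b], lnk [b, c] [y])
  | 35 => (lnk [a, b] [c], lnk [a, c] [b, y], lnk [a, y] [b, c])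
  | 36 => (lnk [a, b] [c], lnk [a, c] [b, y], lnk [a, y] [c])
  | 37 => (lnk [a, b] [c], lnk [a, c] [b, y], lnk [a] [c, y])
  | 38 => (lnk [a, b] [c], lnk [a, c] [b, y], lnk [b] [c, y])
  | 39 => (lnk [a, b] [c], lnk [a, c] [y], lnk [b, c] [y])
  | 40 => (lnk [a, b] [c], lnk [a] [b], lnk [c] [y])
  | 41 => (lnk [a, b] [c], lnk [a] [c, y], lnk [b] [y])
  | 42 => (lnk [a, b] [c], lnk [a] [y], lnk [b] [y])
  | 43 => (lnk [a] [b], lnk [a] [c], lnk [b] [y])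
  | 44 => (lnk [a, b] [c], lnk [a, c] [y], lnk [a, y] [b])
  | 45 => (lnk [a, b, c] [y], lnk [a, b, y] [c], lnk [a, b] [c, y])
  | 46 => (lnk [a, b, c] [y], lnk [a, b, y] [c], lnk [a] [b])
  | 47 => (lnk [a, b] [c], lnk [a, b] [y], lnk [a] [b])
  | 48 => (lnk [a, b, c] [y], lnk [a, b, y] [c], lnk [a, c, y] [b])
  | 49 => (lnk [a, b] [c], lnk [a, c] [b], lnk [a] [b, c])
  | 50 => (lnk [a, b] [c], lnk [a, y] [c], lnk [b, y] [c])
  | 51 => (lnk [a] [b], lnk [a] [c], lnk [a] [y])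
  | 52 => (lnk [a, b] [c, y], lnk [a] [b], lnk [c] [y])
  | 53 => (lnk [a, b] [c, y], lnk [a, c] [b, y], lnk [a, y] [b, c])
  | _ => (pTrue, pTrue, pTrue)  -- unreachable (the `Fin 54` literal patterns above are exhaustive; the match compiler does not see it at this size)

/-- The `E₃` term family of row `i`. [this work] -/
def terms (i : Fin 54) (n : ℕ) (x : Quad n) : List (CTerm n) :=
  e3Terms (row i n x).1 (row i n x).2.1 (row i n x).2.2

/-- Each family commutes with vertex relabellings. [this work] -/
theorem terms_equivariant (i : Fin 54) : QuadEquivariant (terms i) := by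
  intro n τ x
  obtain ⟨a, b, c, y⟩ := x
  fin_cases i <;> rfl

/-- `K₄` checks (base `2^23`): all `4^6` fibre sums nonnegative. [this work] -/
theorem combCheck4 (i : Fin 54) : checkC 4 23 (terms i 4 (quad₀ 4 le_rfl)) = true := by
  fin_cases i <;> native_decide

/-- `K₅` checks (base `2^35`): all `4^10` fibre sums nonnegative. [this work] -/
theorem combCheck5 (i : Fin 54) : checkC 5 35 (terms i 5 (quad₀ 5 (by norm_num))) = true := by
  fin_cases i <;> native_decide

/-- **The 54 essential increasing rows (term form) on every weighted graph with at most five vertices, all weights, all pairwise distinct `a b c y`.** [this work] -/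
theorem frontier_le_five (i : Fin 54) : ∀ n ≤ 5, ∀ (w : Sym2 (Fin n) → unitInterval) (a b c y : Fin n),
    a ≠ b → a ≠ c → a ≠ y → b ≠ c → b ≠ y → c ≠ y → 0 ≤ cval w (terms i n (a, b, c, y)) :=
  quad_cval_le_five (terms_equivariant i) (combCheck4 i) (combCheck5 i)

/-- **The 54 essential increasing rows in `sahiE3` form**: `0 ≤ E₃(U₁, U₂, U₃)` under `prodBernoulli w` for the representative triple `row i` at any pairwise
distinct `a b c y` of a graph with `n ≤ 5` vertices. [this work] -/
theorem frontier_sahiE3_le_five (i : Fin 54) (hn : n ≤ 5) (w : Sym2 (Fin n) → unitInterval) (a b c y : Fin n) (hab : a ≠ b)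
    (hac : a ≠ c) (hay : a ≠ y) (hbc : b ≠ c) (hby : b ≠ y) (hcy : c ≠ y) :
    0 ≤ sahiE3 (prodBernoulli w) (connEvent (row i n (a, b, c, y)).1) (connEvent (row i n (a, b, c, y)).2.1)
      (connEvent (row i n (a, b, c, y)).2.2) := by
  have h := frontier_le_five i n hn w a b c y hab hac hay hbc hby hcy
  unfold terms at h
  rwa [cval_e3Terms] at h

/-- **`γ` on ≤ 5 vertices** (orbit 53, `GammaRow`'s triple `(U[ab|cy], U[ac|by], U[ay|bc])`): `0 ≤ E₃` of the three "the two pairs of the matching are joined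
across" events. [this work] -/
theorem gamma_le_five (hn : n ≤ 5) (w : Sym2 (Fin n) → unitInterval) (a b c y : Fin n) (hab : a ≠ b) (hac : a ≠ c)
    (hay : a ≠ y) (hbc : b ≠ c) (hby : b ≠ y) (hcy : c ≠ y) :
    0 ≤ sahiE3 (prodBernoulli w) {ω | ∃ x ∈ [a, b], ∃ z ∈ [c, y], ω ∈ openConn x z} {ω | ∃ x ∈ [a, c], ∃ z ∈ [b, y], ω ∈ openConn x z}
      {ω | ∃ x ∈ [a, y], ∃ z ∈ [b, c], ω ∈ openConn x z} := by
  have h := frontier_sahiE3_le_five 53 hn w a b c y hab hac hay hbc hby hcy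
  simpa only [row, connEvent_lnk] using h

/-- **The increasing STAR on ≤ 5 vertices** (orbit 51): `0 ≤ E₃({a↔b}, {a↔c}, {a↔y})`. [this work] -/
theorem incStar_le_five (hn : n ≤ 5) (w : Sym2 (Fin n) → unitInterval) (a b c y : Fin n) (hab : a ≠ b) (hac : a ≠ c)
    (hay : a ≠ y) (hbc : b ≠ c) (hby : b ≠ y) (hcy : c ≠ y) :
    0 ≤ sahiE3 (prodBernoulli w) (openConn a b) (openConn a c) (openConn a y) := by
  have h := frontier_sahiE3_le_five 51 hn w a b c y hab hac hay hbc hby hcy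
  simpa only [row, connEvent_lnk, List.mem_singleton, exists_eq_left, Set.setOf_mem_eq] using h

end Summit.CriticalPhenomena.PercolationContinuityZ3.Theorems.FrontierIncRows
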